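import Mathlib
import Literature.NumberTheory.LFunctions.Zhang2022.Section14Eq146CharExpansion
import Literature.NumberTheory.LFunctions.Zhang2022.Section14Eq146Principal
import Literature.NumberTheory.Sieve.DivisorBound
import HarnessLib

/-!
# Zhang (2022) §14, towards (14.6): the reduction of (14.6) to the non-principal characters at the
# modulus `D₂k`, with a generic weight on the prime window — kernel-checked

Topic `Literature/NumberTheory/LFunctions/Zhang2022` (Landau–Siegel audit tree; verdict-neutral).
Y. Zhang, *Discrete mean estimates and the Landau–Siegel zero*, arXiv:2211.02515v1 (2022)
[Zhang2022LandauSiegel] — **an unrefereed manuscript under adjudication**; nothing here asserts or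
denies its Theorems 1–2 or Proposition 14.1. ZHANG-L discharge lane (helper under the leaf
`Skeleton.Prop141`, node `Z22:(14.6)` = `Typed.Sec14.Eq146`, GAP row G-adj2-4 "the (14.6) analogue";
the manuscript's own text for (14.6) is one sentence, p. 79 tex L3966–L3969: "similar … the main terms …
do not appear").

Building on (14.7)′ (`calS_charExpansion`) and the u013 twin (`princTerm₂_bound`), this file reduces
the window sum `Σ_{p∼P} w(p)𝒮(D₁,D₂;p)` — for an ARBITRARY weight `w` on the window (the chain of
record uses `w(p) = χ(p)`; the general-`β` form of Proposition 14.1 uses `w(p) = χ(p)(pt₀)^β`) — to the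
(14.8)-shaped majorant of the non-principal characters `θ (mod D₂k)`:

* `sum_window_tsum_exchange₂w`, `norm_sum_window_nonprincipal_le₂w` — the weight-generic forms of the
  exchange of `Σ_{p∼P}` with the `l`-series (absolutely convergent under (14.1)) and of the resulting
  majorant (the `χ`-weight versions are in `Section14Eq146CharExpansion`).
* `norm_sum_window_calS_le` — **the exact reduction**: for every `B` there are `C ≥ 0`, `D₀` with, for
  `D ≥ D₀`, `χ` real primitive, `κ*, a*` under (14.1)–(14.2), `D = D₁D₂`, and any weight with
  `|w(p)| ≤ W` on the window,
  `‖Σ_{p∼P} w(p)𝒮(D₁,D₂;p)‖ ≤ 3W·C·d(D₁)⁴·P²·𝓛⁸⁴⁵ + Σ_d d⁻¹ Σ_{(k,D₁)=1} |a*(dk)|/(φ(D₂k)k)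
  Σ_{θ≠ψ⁰ (mod D₂k)} |τ(θ̄)|·‖Σ_l κ*(D₁dl)θ(l) Σ_{p∼P} w(p)θ̄(p)Δ(l/(D₂pk))‖`.
* `eq146_of_nonprincipal` — **(14.6) ⇐ the non-principal estimate** (weight `χ`): if for every `B`
  the last majorant is `≤ C·P²·D^{−c}` eventually under (A) for all `D = D₁D₂` with `D₁ > 1`, then
  `Typed.Sec14.Eq146` holds (`d(D₁)⁴ ≤ C_δ D^{1/8}` by the divisor bound and `𝓛⁸⁴⁵ ≤ D^{1/4}`
  eventually, so the principal characters cost `P²D^{3/8} ≤ P²D^{1/2−c'}`, `c' = min(c, 1/8)`).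

What remains of (14.6) after this file is exactly the twin at modulus `D₂k` of u017 (re-indexing the
non-principal `θ (mod D₂k)` by conductor `r > 1` and primitive `θ* (mod r)`, `|τ(θ̄)| ≤ √r`, where
`(k,D₁) = 1`, `D₁ > 1` make `θ* ≠ χ` automatic) and the two (14.8)-type legs ("Mellin transform,
Lemma 5.4 (i) and Lemma 5.6 / the large sieve") for the coefficients `κ*(D₁d·)` — no new definition is
introduced here; the hypothesis of `eq146_of_nonprincipal` is spelled out.

## References

* Y. Zhang, arXiv:2211.02515v1 (2022), §14 pp. 77–79: u011, u013, (14.6)–(14.8), tex L3901–L3969.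
  [cite: Zhang2022LandauSiegel, §14 (14.6)–(14.8) pp.78–79]
* G. H. Hardy, E. M. Wright, *An Introduction to the Theory of Numbers*, Thm 315 (divisor bound), via
  `Literature.NumberTheory.Sieve.DivisorBound`. [cite: HardyWright2008, Theorem 315]
-/

noncomputable section

open Complex Real ComplexConjugate

namespace Literature.NumberTheory.LFunctions.Zhang2022.Typed.Sec14

open Skeleton

/-! ## Weight-generic exchange and majorant -/

section Weighted

variable {D : ℕ}

/-- **Exchanging `Σ_{p∼P}` with the `l`-series, generic weight** `w(p)` on the window (modulus `D₂k`;
absolutely convergent under (14.1) by `summable_kappa_mul_DeltaW`), and `θ(−l) = θ(−1)θ(l)`.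
[cite: Zhang2022LandauSiegel, §14 (14.8) p.79] -/
theorem sum_window_tsum_exchange₂w (hD : 3 ≤ D) {B : ℝ} {κs : ℕ → ℂ} (hκ : Eq141 B κs)
    (w : ℕ → ℂ) (D₁ D₂ d k : ℕ) (hD₂ : 1 ≤ D₂) (hk : 1 ≤ k) (θ : DirichletCharacter ℂ (D₂ * k)) :
    ∑ p ∈ primeWindow D, w p * θ⁻¹ (p : ZMod (D₂ * k)) *
        ∑' l : ℕ, κs (D₁ * d * l) * θ (-(l : ZMod (D₂ * k))) *
          DeltaW D ((l : ℝ) / ((D₂ : ℝ) * p * k)) =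
      θ (-1) * ∑' l : ℕ, κs (D₁ * d * l) * θ (l : ZMod (D₂ * k)) *
        ∑ p ∈ primeWindow D, w p * θ⁻¹ (p : ZMod (D₂ * k)) *
          DeltaW D ((l : ℝ) / ((D₂ : ℝ) * p * k)) := by
  have hsum : ∀ p ∈ primeWindow D, Summable fun l : ℕ =>
      w p * θ⁻¹ (p : ZMod (D₂ * k)) *
        (κs (D₁ * d * l) * θ (-(l : ZMod (D₂ * k))) * DeltaW D ((l : ℝ) / ((D₂ : ℝ) * p * k))) := by
    intro p hp
    have hp0 : (0 : ℝ) < p := by exact_mod_cast (Finset.mem_filter.mp hp).2.pos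
    have hD0 : (0 : ℝ) < D₂ := by exact_mod_cast hD₂
    have hk0 : (0 : ℝ) < k := by exact_mod_cast hk
    have hQ : (0 : ℝ) < (D₂ : ℝ) * p * k := by positivity
    exact (summable_kappa_mul_DeltaW hD hκ (D₁ * d) hQ (g := fun l => θ (-(l : ZMod (D₂ * k))))
      (G := 1) (fun l => DirichletCharacter.norm_le_one θ _)).mul_left _
  calc ∑ p ∈ primeWindow D, w p * θ⁻¹ (p : ZMod (D₂ * k)) *
        ∑' l : ℕ, κs (D₁ * d * l) * θ (-(l : ZMod (D₂ * k))) *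
          DeltaW D ((l : ℝ) / ((D₂ : ℝ) * p * k))
      = ∑ p ∈ primeWindow D, ∑' l : ℕ, w p * θ⁻¹ (p : ZMod (D₂ * k)) *
          (κs (D₁ * d * l) * θ (-(l : ZMod (D₂ * k))) *
            DeltaW D ((l : ℝ) / ((D₂ : ℝ) * p * k))) := by
        refine Finset.sum_congr rfl fun p _ => ?_
        rw [tsum_mul_left]
    _ = ∑' l : ℕ, ∑ p ∈ primeWindow D, w p * θ⁻¹ (p : ZMod (D₂ * k)) *
          (κs (D₁ * d * l) * θ (-(l : ZMod (D₂ * k))) *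
            DeltaW D ((l : ℝ) / ((D₂ : ℝ) * p * k))) :=
        (Summable.tsum_finsetSum hsum).symm
    _ = ∑' l : ℕ, θ (-1) * (κs (D₁ * d * l) * θ (l : ZMod (D₂ * k)) *
          ∑ p ∈ primeWindow D, w p * θ⁻¹ (p : ZMod (D₂ * k)) *
            DeltaW D ((l : ℝ) / ((D₂ : ℝ) * p * k))) := by
        refine tsum_congr fun l => ?_
        have hneg : θ (-(l : ZMod (D₂ * k))) = θ (-1) * θ (l : ZMod (D₂ * k)) := by
          rw [← map_mul, neg_one_mul]
        rw [Finset.mul_sum, Finset.mul_sum]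
        refine Finset.sum_congr rfl fun p _ => ?_
        rw [hneg]; ring
    _ = _ := tsum_mul_left

/-- **The non-principal characters' contribution with a generic window weight `w` is bounded by the
(14.8)-shaped majorant at the modulus `D₂k`** (exchange of `Σ_{p∼P}` with the `l`-series, `|θ(−1)| ≤ 1`),
for `D ≥ 3`, under (14.1), `D₂ ≥ 1`, any finite set `K` of `k ≥ 1`.
[cite: Zhang2022LandauSiegel, §14 (14.8) p.79 and (14.6) proof p.79, tex L3945, L3966–L3969] -/
theorem norm_sum_window_nonprincipal_le₂w (hD : 3 ≤ D) {B : ℝ} {κs : ℕ → ℂ} (hκ : Eq141 B κs)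
    (as : ℕ → ℂ) (w : ℕ → ℂ) (D₁ D₂ : ℕ) (hD₂ : 1 ≤ D₂) (K : Finset ℕ) (hK : ∀ k ∈ K, 1 ≤ k) :
    ‖∑ p ∈ primeWindow D, w p *
        ∑ d ∈ Finset.Icc 1 ⌊2 * P4 D⌋₊, (d : ℂ)⁻¹ * ∑ k ∈ K,
          as (d * k) / ((k : ℂ) * Nat.totient (D₂ * k)) *
            ∑ θ ∈ finsetOf {θ : DirichletCharacter ℂ (D₂ * k) | θ ≠ 1},
              tauSum (D₂ * k) θ⁻¹ * θ⁻¹ (p : ZMod (D₂ * k)) *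
                ∑' l : ℕ, κs (D₁ * d * l) * θ (-(l : ZMod (D₂ * k))) *
                  DeltaW D ((l : ℝ) / ((D₂ : ℝ) * p * k))‖ ≤
      ∑ d ∈ Finset.Icc 1 ⌊2 * P4 D⌋₊, (d : ℝ)⁻¹ * ∑ k ∈ K,
        ‖as (d * k)‖ / ((Nat.totient (D₂ * k) : ℝ) * k) *
          ∑ θ ∈ finsetOf {θ : DirichletCharacter ℂ (D₂ * k) | θ ≠ 1},
            ‖tauSum (D₂ * k) θ⁻¹‖ *
              ‖∑' l : ℕ, κs (D₁ * d * l) * θ (l : ZMod (D₂ * k)) *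
                  ∑ p ∈ primeWindow D, w p * θ⁻¹ (p : ZMod (D₂ * k)) *
                    DeltaW D ((l : ℝ) / ((D₂ : ℝ) * p * k))‖ := by
  -- move the `p`-sum inside
  have hre : ∑ p ∈ primeWindow D, w p *
        ∑ d ∈ Finset.Icc 1 ⌊2 * P4 D⌋₊, (d : ℂ)⁻¹ * ∑ k ∈ K,
          as (d * k) / ((k : ℂ) * Nat.totient (D₂ * k)) *
            ∑ θ ∈ finsetOf {θ : DirichletCharacter ℂ (D₂ * k) | θ ≠ 1},
              tauSum (D₂ * k) θ⁻¹ * θ⁻¹ (p : ZMod (D₂ * k)) *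
                ∑' l : ℕ, κs (D₁ * d * l) * θ (-(l : ZMod (D₂ * k))) *
                  DeltaW D ((l : ℝ) / ((D₂ : ℝ) * p * k)) =
      ∑ d ∈ Finset.Icc 1 ⌊2 * P4 D⌋₊, (d : ℂ)⁻¹ * ∑ k ∈ K,
          as (d * k) / ((k : ℂ) * Nat.totient (D₂ * k)) *
            ∑ θ ∈ finsetOf {θ : DirichletCharacter ℂ (D₂ * k) | θ ≠ 1},
              tauSum (D₂ * k) θ⁻¹ * (θ (-1) * ∑' l : ℕ, κs (D₁ * d * l) * θ (l : ZMod (D₂ * k)) *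
                ∑ p ∈ primeWindow D, w p * θ⁻¹ (p : ZMod (D₂ * k)) *
                  DeltaW D ((l : ℝ) / ((D₂ : ℝ) * p * k))) := by
    have lhs : ∑ p ∈ primeWindow D, w p *
        ∑ d ∈ Finset.Icc 1 ⌊2 * P4 D⌋₊, (d : ℂ)⁻¹ * ∑ k ∈ K,
          as (d * k) / ((k : ℂ) * Nat.totient (D₂ * k)) *
            ∑ θ ∈ finsetOf {θ : DirichletCharacter ℂ (D₂ * k) | θ ≠ 1},
              tauSum (D₂ * k) θ⁻¹ * θ⁻¹ (p : ZMod (D₂ * k)) *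
                ∑' l : ℕ, κs (D₁ * d * l) * θ (-(l : ZMod (D₂ * k))) *
                  DeltaW D ((l : ℝ) / ((D₂ : ℝ) * p * k)) =
        ∑ d ∈ Finset.Icc 1 ⌊2 * P4 D⌋₊, ∑ k ∈ K,
          ∑ θ ∈ finsetOf {θ : DirichletCharacter ℂ (D₂ * k) | θ ≠ 1},
            (d : ℂ)⁻¹ * (as (d * k) / ((k : ℂ) * Nat.totient (D₂ * k))) * tauSum (D₂ * k) θ⁻¹ *
              ∑ p ∈ primeWindow D, w p * θ⁻¹ (p : ZMod (D₂ * k)) *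
                ∑' l : ℕ, κs (D₁ * d * l) * θ (-(l : ZMod (D₂ * k))) *
                  DeltaW D ((l : ℝ) / ((D₂ : ℝ) * p * k)) := by
      simp only [Finset.mul_sum]
      rw [Finset.sum_comm]
      refine Finset.sum_congr rfl fun d _ => ?_
      rw [Finset.sum_comm]
      refine Finset.sum_congr rfl fun k _ => ?_
      rw [Finset.sum_comm]
      refine Finset.sum_congr rfl fun θ _ => Finset.sum_congr rfl fun p _ => ?_
      ring
    rw [lhs]
    have step : ∀ d ∈ Finset.Icc 1 ⌊2 * P4 D⌋₊, ∀ k ∈ K,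
        ∀ θ ∈ finsetOf {θ : DirichletCharacter ℂ (D₂ * k) | θ ≠ 1},
        (d : ℂ)⁻¹ * (as (d * k) / ((k : ℂ) * Nat.totient (D₂ * k))) * tauSum (D₂ * k) θ⁻¹ *
            ∑ p ∈ primeWindow D, w p * θ⁻¹ (p : ZMod (D₂ * k)) *
              ∑' l : ℕ, κs (D₁ * d * l) * θ (-(l : ZMod (D₂ * k))) *
                DeltaW D ((l : ℝ) / ((D₂ : ℝ) * p * k)) =
          (d : ℂ)⁻¹ * (as (d * k) / ((k : ℂ) * Nat.totient (D₂ * k)) *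
            (tauSum (D₂ * k) θ⁻¹ * (θ (-1) * ∑' l : ℕ, κs (D₁ * d * l) * θ (l : ZMod (D₂ * k)) *
              ∑ p ∈ primeWindow D, w p * θ⁻¹ (p : ZMod (D₂ * k)) *
                DeltaW D ((l : ℝ) / ((D₂ : ℝ) * p * k))))) := by
      intro d _ k hk θ _
      rw [sum_window_tsum_exchange₂w hD hκ w D₁ D₂ d k hD₂ (hK k hk) θ]
      ring
    rw [Finset.sum_congr rfl fun d hd => Finset.sum_congr rfl fun k hk =>
      Finset.sum_congr rfl fun θ hθ => step d hd k hk θ hθ]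
    simp only [← Finset.mul_sum]
  rw [hre]
  refine (norm_sum_le _ _).trans (Finset.sum_le_sum fun d _ => ?_)
  rw [norm_mul, norm_inv, Complex.norm_natCast]
  refine mul_le_mul_of_nonneg_left ?_ (by positivity)
  refine (norm_sum_le _ _).trans (Finset.sum_le_sum fun k _ => ?_)
  rw [norm_mul, norm_div, norm_mul, Complex.norm_natCast, Complex.norm_natCast, mul_comm (k : ℝ)]
  refine mul_le_mul_of_nonneg_left ?_ (by positivity)
  refine (norm_sum_le _ _).trans (Finset.sum_le_sum fun θ _ => ?_)
  rw [norm_mul, norm_mul]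
  refine mul_le_mul_of_nonneg_left ?_ (norm_nonneg _)
  calc ‖θ (-1)‖ * ‖∑' l : ℕ, κs (D₁ * d * l) * θ (l : ZMod (D₂ * k)) *
          ∑ p ∈ primeWindow D, w p * θ⁻¹ (p : ZMod (D₂ * k)) *
            DeltaW D ((l : ℝ) / ((D₂ : ℝ) * p * k))‖
      ≤ 1 * ‖∑' l : ℕ, κs (D₁ * d * l) * θ (l : ZMod (D₂ * k)) *
          ∑ p ∈ primeWindow D, w p * θ⁻¹ (p : ZMod (D₂ * k)) *
            DeltaW D ((l : ℝ) / ((D₂ : ℝ) * p * k))‖ := by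
        gcongr; exact DirichletCharacter.norm_le_one θ _
    _ = _ := one_mul _

end Weighted

/-! ## The exact reduction of the weighted window sum of `𝒮(D₁,D₂;p)` -/

/-- **The reduction of `Σ_{p∼P} w(p)𝒮(D₁,D₂;p)` to the non-principal characters.** For every `B`
there are `C ≥ 0` and `D₀` such that for `D ≥ D₀`, every real primitive `χ (mod D)`, all `κ*, a*`
subject to (14.1)–(14.2), every factorisation `D = D₁D₂` and every weight `w` with `|w(p)| ≤ W` on the
window: `‖Σ_{p∼P} w(p)𝒮(D₁,D₂;p)‖ ≤ 3W·C·d(D₁)⁴·P²·𝓛⁸⁴⁵ + [(14.8)-shaped majorant of the θ ≠ ψ⁰_{D₂k}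
with weight w]` — (14.7)′ per `p` (`calS_charExpansion`), the split `ψ⁰ + rest` (`calS_split₂`), the
principal terms `≤ C·d(D₁)⁴·P·𝓛⁸⁴⁵` each (`princTerm₂_bound`) over `≤ 3P` primes
(`card_primeWindow_le`), the rest by `norm_sum_window_nonprincipal_le₂w`. No Assumption (A).
[cite: Zhang2022LandauSiegel, §14 (14.6)–(14.8) pp.78–79, tex L3915–L3969] -/
theorem norm_sum_window_calS_le (B : ℝ) : ∃ C : ℝ, 0 ≤ C ∧ ∃ D₀ : ℕ, ∀ D : ℕ, D₀ ≤ D →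
    ∀ (_ : NeZero D) (χ : DirichletCharacter ℂ D), χ.IsQuadratic → χ.IsPrimitive →
    ∀ κs as : ℕ → ℂ, Eq141 B κs → Eq142 D B as → ∀ D₁ D₂ : ℕ, D₁ * D₂ = D →
      ∀ (w : ℕ → ℂ) (W : ℝ), 0 ≤ W → (∀ p ∈ primeWindow D, ‖w p‖ ≤ W) →
        ‖∑ p ∈ primeWindow D, w p * calS D D₁ D₂ p κs as‖ ≤
          3 * W * C * (D₁.divisors.card : ℝ) ^ 4 * bigP D ^ 2 * ell D ^ (845 : ℕ) +
          ∑ d ∈ Finset.Icc 1 ⌊2 * P4 D⌋₊, (d : ℝ)⁻¹ *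
            ∑ k ∈ (Finset.Icc 1 ⌊2 * P4 D⌋₊).filter (fun k => Nat.Coprime k D₁),
              ‖as (d * k)‖ / ((Nat.totient (D₂ * k) : ℝ) * k) *
                ∑ θ ∈ finsetOf {θ : DirichletCharacter ℂ (D₂ * k) | θ ≠ 1},
                  ‖tauSum (D₂ * k) θ⁻¹‖ *
                    ‖∑' l : ℕ, κs (D₁ * d * l) * θ (l : ZMod (D₂ * k)) *
                        ∑ p ∈ primeWindow D, w p * θ⁻¹ (p : ZMod (D₂ * k)) *
                          DeltaW D ((l : ℝ) / ((D₂ : ℝ) * p * k))‖ := by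
  obtain ⟨C, hC0, Dp, hprinc⟩ := princTerm₂_bound B
  obtain ⟨De, hexp⟩ := calS_charExpansion
  refine ⟨C, hC0, max (max Dp De) 3, fun D hD _ χ hq hprim κs as h141 h142 D₁ D₂ hD₁₂ w W hW0 hw => ?_⟩
  have hDp : Dp ≤ D := le_trans (le_trans (le_max_left _ _) (le_max_left _ _)) hD
  have hDe : De ≤ D := le_trans (le_trans (le_max_right _ _) (le_max_left _ _)) hD
  have hD3 : 3 ≤ D := le_trans (le_max_right _ _) hD
  have hD₂0 : 0 < D₂ := Nat.pos_of_ne_zero fun h => by subst h; omega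
  -- names for the principal term and the rest at `p`
  set Pr : ℕ → ℂ := fun p => ∑ d ∈ Finset.Icc 1 ⌊2 * P4 D⌋₊, (d : ℂ)⁻¹ *
      ∑ k ∈ (Finset.Icc 1 ⌊2 * P4 D⌋₊).filter (fun k => Nat.Coprime k D₁),
        as (d * k) / ((k : ℂ) * Nat.totient (D₂ * k)) *
          (tauSum (D₂ * k) (1 : DirichletCharacter ℂ (D₂ * k))⁻¹ *
              (1 : DirichletCharacter ℂ (D₂ * k))⁻¹ (p : ZMod (D₂ * k)) *
            ∑' l : ℕ, κs (D₁ * d * l) * (1 : DirichletCharacter ℂ (D₂ * k)) (-(l : ZMod (D₂ * k))) *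
              DeltaW D ((l : ℝ) / ((D₂ : ℝ) * p * k))) with hPr
  set Re : ℕ → ℂ := fun p => ∑ d ∈ Finset.Icc 1 ⌊2 * P4 D⌋₊, (d : ℂ)⁻¹ *
      ∑ k ∈ (Finset.Icc 1 ⌊2 * P4 D⌋₊).filter (fun k => Nat.Coprime k D₁),
        as (d * k) / ((k : ℂ) * Nat.totient (D₂ * k)) *
          ∑ θ ∈ finsetOf {θ : DirichletCharacter ℂ (D₂ * k) | θ ≠ 1},
            tauSum (D₂ * k) θ⁻¹ * θ⁻¹ (p : ZMod (D₂ * k)) *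
              ∑' l : ℕ, κs (D₁ * d * l) * θ (-(l : ZMod (D₂ * k))) *
                DeltaW D ((l : ℝ) / ((D₂ : ℝ) * p * k)) with hRe
  have hsplit : ∀ p ∈ primeWindow D, calS D D₁ D₂ p κs as = Pr p + Re p := by
    intro p hp
    exact calS_split₂ D₁ D₂ p hD₂0 κs as (hexp D hDe p hp D₁ D₂ hD₁₂ κs as)
  have hsum : ∑ p ∈ primeWindow D, w p * calS D D₁ D₂ p κs as =
      ∑ p ∈ primeWindow D, w p * Pr p + ∑ p ∈ primeWindow D, w p * Re p := by
    rw [← Finset.sum_add_distrib]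
    refine Finset.sum_congr rfl fun p hp => ?_
    rw [hsplit p hp, mul_add]
  rw [hsum]
  refine (norm_add_le _ _).trans (add_le_add ?_ ?_)
  · -- the principal characters: `≤ 3P` primes, each `≤ W · C d(D₁)⁴ P 𝓛⁸⁴⁵`
    have hP0 : 0 ≤ bigP D := (Real.exp_pos _).le
    have hℓ : 0 ≤ ell D ^ (845 : ℕ) := pow_nonneg (Real.log_natCast_nonneg D) _
    calc ‖∑ p ∈ primeWindow D, w p * Pr p‖
        ≤ ∑ p ∈ primeWindow D, ‖w p * Pr p‖ := norm_sum_le _ _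
      _ ≤ ∑ p ∈ primeWindow D, W * (C * (D₁.divisors.card : ℝ) ^ 4 * bigP D * ell D ^ (845 : ℕ)) := by
          refine Finset.sum_le_sum fun p hp => ?_
          rw [norm_mul]
          exact mul_le_mul (hw p hp) (hprinc D hDp inferInstance χ hq hprim p hp κs as h141 h142 D₁ D₂ hD₁₂)
            (norm_nonneg _) hW0
      _ = (primeWindow D).card * (W * (C * (D₁.divisors.card : ℝ) ^ 4 * bigP D * ell D ^ (845 : ℕ))) := by
          rw [Finset.sum_const, nsmul_eq_mul]
      _ ≤ (3 * bigP D) * (W * (C * (D₁.divisors.card : ℝ) ^ 4 * bigP D * ell D ^ (845 : ℕ))) := by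
          have : 0 ≤ W * (C * (D₁.divisors.card : ℝ) ^ 4 * bigP D * ell D ^ (845 : ℕ)) := by positivity
          exact mul_le_mul_of_nonneg_right (card_primeWindow_le hD3) this
      _ = 3 * W * C * (D₁.divisors.card : ℝ) ^ 4 * bigP D ^ 2 * ell D ^ (845 : ℕ) := by ring
  · -- the non-principal characters
    have hK : ∀ k ∈ (Finset.Icc 1 ⌊2 * P4 D⌋₊).filter (fun k => Nat.Coprime k D₁), 1 ≤ k :=
      fun k hk => (Finset.mem_Icc.mp (Finset.mem_filter.mp hk).1).1
    simpa only [hRe] using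
      norm_sum_window_nonprincipal_le₂w hD3 h141 as w D₁ D₂ hD₂0 _ hK

/-! ## (14.6) from the non-principal estimate (weight `χ`) -/

/-- **(14.6) ⇐ the non-principal-character estimate at the modulus `D₂k`.** If, for every `B`, the
(14.8)-shaped majorant of the characters `θ ≠ ψ⁰ (mod D₂k)` (weight `χ(p)`, coefficients `κ*(D₁d·)`,
`(k,D₁) = 1`) is `≤ C·P²·D^{−c}` for all large `D` under (A), for all `κ*, a*` subject to (14.1)–(14.2)
and every factorisation `D = D₁D₂` with `D₁ > 1`, then **(14.6)** `Typed.Sec14.Eq146` holds: by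
`norm_sum_window_calS_le` (with `W = 1`, `|χ(p)| ≤ 1`) the principal characters cost
`3C·d(D₁)⁴·P²·𝓛⁸⁴⁵ ≤ C'·P²·D^{3/8}` (`d(D₁) ≤ C_δ D₁^{1/32} ≤ C_δ D^{1/32}` by the divisor bound,
`𝓛⁸⁴⁵ ≤ D^{1/4}` eventually), and `D^{3/8}, D^{−c} ≤ D^{1/2−c'}` for `c' = min(c, 1/8)`. This is the
unprinted "(14.6) is similar" (p. 79) made explicit down to the two (14.8)-type legs at modulus `D₂k`.
[cite: Zhang2022LandauSiegel, §14 (14.6) pp.78–79, tex L3915, L3966–L3969] -/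
theorem eq146_of_nonprincipal
    (hnp : ∀ B : ℝ, ∃ c : ℝ, 0 < c ∧ ∃ C : ℝ, ForAllLarge fun D _ χ => AssumptionA D χ →
      ∀ κs as : ℕ → ℂ, Eq141 B κs → Eq142 D B as → ∀ D₁ D₂ : ℕ, D₁ * D₂ = D → 1 < D₁ →
        ∑ d ∈ Finset.Icc 1 ⌊2 * P4 D⌋₊, (d : ℝ)⁻¹ *
            ∑ k ∈ (Finset.Icc 1 ⌊2 * P4 D⌋₊).filter (fun k => Nat.Coprime k D₁),
              ‖as (d * k)‖ / ((Nat.totient (D₂ * k) : ℝ) * k) *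
                ∑ θ ∈ finsetOf {θ : DirichletCharacter ℂ (D₂ * k) | θ ≠ 1},
                  ‖tauSum (D₂ * k) θ⁻¹‖ *
                    ‖∑' l : ℕ, κs (D₁ * d * l) * θ (l : ZMod (D₂ * k)) *
                        ∑ p ∈ primeWindow D, χ (p : ZMod D) * θ⁻¹ (p : ZMod (D₂ * k)) *
                          DeltaW D ((l : ℝ) / ((D₂ : ℝ) * p * k))‖
          ≤ C * bigP D ^ 2 * (D : ℝ) ^ (-c)) :
    Eq146 := by
  intro B
  obtain ⟨c, hc, C, Dn, hn⟩ := hnp B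
  obtain ⟨Cp, hCp0, Dr, hred⟩ := norm_sum_window_calS_le B
  obtain ⟨Cd, hCd1, hCd⟩ :=
    Literature.NumberTheory.Sieve.exists_card_divisors_le_mul_rpow (show (0 : ℝ) < 1 / 32 by norm_num)
  obtain ⟨Dl, hDl⟩ := eventually_log_rpow_le_rpow_quarter (845 : ℝ)
  set c' : ℝ := min c (1 / 8) with hc'
  refine ⟨c', lt_min hc (by norm_num), 3 * Cp * Cd ^ 4 + |C|, ?_⟩
  refine ⟨max (max Dn Dr) (max Dl 3), fun D _ χ hD hq hprim hA κs as h141 h142 D₁ D₂ hD₁₂ hD₁ => ?_⟩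
  have hDn : Dn ≤ D := le_trans (le_trans (le_max_left _ _) (le_max_left _ _)) hD
  have hDr : Dr ≤ D := le_trans (le_trans (le_max_right _ _) (le_max_left _ _)) hD
  have hDl' : Dl ≤ D := le_trans (le_trans (le_max_left _ _) (le_max_right _ _)) hD
  have hD3 : 3 ≤ D := le_trans (le_trans (le_max_right _ _) (le_max_right _ _)) hD
  have hD1 : (1 : ℝ) ≤ D := by exact_mod_cast (show 1 ≤ D by omega)
  have hD0 : (0 : ℝ) < D := by linarith
  have hP2 : 0 ≤ bigP D ^ 2 := sq_nonneg _
  -- the reduction with `w = χ`, `W = 1`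
  have hw : ∀ p ∈ primeWindow D, ‖χ (p : ZMod D)‖ ≤ 1 := fun p _ => DirichletCharacter.norm_le_one χ _
  have h1 := hred D hDr inferInstance χ hq hprim κs as h141 h142 D₁ D₂ hD₁₂
    (fun p => χ (p : ZMod D)) 1 zero_le_one hw
  have h2 := hn D χ hDn hq hprim hA κs as h141 h142 D₁ D₂ hD₁₂ hD₁
  -- sizes: `d(D₁)⁴ ≤ Cd⁴ D^{1/8}`, `𝓛⁸⁴⁵ ≤ D^{1/4}`
  have hD₁0 : D₁ ≠ 0 := by omega
  have hD₁D : (D₁ : ℝ) ≤ D := by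
    have hD₂1 : 1 ≤ D₂ := Nat.pos_of_ne_zero fun h => by subst h; omega
    have : D₁ ≤ D := by
      calc D₁ = D₁ * 1 := (mul_one _).symm
        _ ≤ D₁ * D₂ := Nat.mul_le_mul_left _ hD₂1
        _ = D := hD₁₂
    exact_mod_cast this
  have hdiv : (D₁.divisors.card : ℝ) ^ 4 ≤ Cd ^ 4 * (D : ℝ) ^ (1 / 8 : ℝ) := by
    have h := hCd D₁ hD₁0
    have hD₁0' : (0 : ℝ) ≤ D₁ := Nat.cast_nonneg _
    have h' : (D₁.divisors.card : ℝ) ≤ Cd * (D : ℝ) ^ (1 / 32 : ℝ) :=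
      h.trans (mul_le_mul_of_nonneg_left (Real.rpow_le_rpow hD₁0' hD₁D (by norm_num))
        (by linarith))
    calc (D₁.divisors.card : ℝ) ^ 4 ≤ (Cd * (D : ℝ) ^ (1 / 32 : ℝ)) ^ 4 :=
          pow_le_pow_left₀ (Nat.cast_nonneg _) h' 4
      _ = Cd ^ 4 * ((D : ℝ) ^ (1 / 32 : ℝ)) ^ 4 := mul_pow _ _ _
      _ = Cd ^ 4 * (D : ℝ) ^ (1 / 8 : ℝ) := by
          rw [← Real.rpow_natCast ((D : ℝ) ^ (1 / 32 : ℝ)) 4, ← Real.rpow_mul hD0.le]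
          norm_num
  have hlog : ell D ^ (845 : ℕ) ≤ (D : ℝ) ^ (1 / 4 : ℝ) := by
    have := hDl D hDl'
    rw [ell, ← Real.rpow_natCast]
    exact_mod_cast this
  -- exponents
  have hc'c : c' ≤ c := min_le_left _ _
  have hc'8 : c' ≤ 1 / 8 := min_le_right _ _
  have h38 : (D : ℝ) ^ (1 / 8 : ℝ) * (D : ℝ) ^ (1 / 4 : ℝ) ≤ (D : ℝ) ^ (1 / 2 - c') := by
    rw [← Real.rpow_add hD0]
    exact Real.rpow_le_rpow_of_exponent_le hD1 (by linarith)
  have hcc : (D : ℝ) ^ (-c) ≤ (D : ℝ) ^ (1 / 2 - c') :=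
    Real.rpow_le_rpow_of_exponent_le hD1 (by linarith)
  -- the principal part
  have hprinc : 3 * 1 * Cp * (D₁.divisors.card : ℝ) ^ 4 * bigP D ^ 2 * ell D ^ (845 : ℕ) ≤
      3 * Cp * Cd ^ 4 * bigP D ^ 2 * (D : ℝ) ^ (1 / 2 - c') := by
    have hℓ0 : 0 ≤ ell D ^ (845 : ℕ) := pow_nonneg (Real.log_natCast_nonneg D) _
    calc 3 * 1 * Cp * (D₁.divisors.card : ℝ) ^ 4 * bigP D ^ 2 * ell D ^ (845 : ℕ)
        = 3 * Cp * bigP D ^ 2 * ((D₁.divisors.card : ℝ) ^ 4 * ell D ^ (845 : ℕ)) := by ring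
      _ ≤ 3 * Cp * bigP D ^ 2 * ((Cd ^ 4 * (D : ℝ) ^ (1 / 8 : ℝ)) * (D : ℝ) ^ (1 / 4 : ℝ)) := by
          have h0 : 0 ≤ 3 * Cp * bigP D ^ 2 := by positivity
          exact mul_le_mul_of_nonneg_left
            (mul_le_mul hdiv hlog hℓ0 (by positivity)) h0
      _ = 3 * Cp * Cd ^ 4 * bigP D ^ 2 * ((D : ℝ) ^ (1 / 8 : ℝ) * (D : ℝ) ^ (1 / 4 : ℝ)) := by ring
      _ ≤ 3 * Cp * Cd ^ 4 * bigP D ^ 2 * (D : ℝ) ^ (1 / 2 - c') := by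
          have h0 : 0 ≤ 3 * Cp * Cd ^ 4 * bigP D ^ 2 := by positivity
          exact mul_le_mul_of_nonneg_left h38 h0
  -- the non-principal part
  have hnonp : C * bigP D ^ 2 * (D : ℝ) ^ (-c) ≤ |C| * bigP D ^ 2 * (D : ℝ) ^ (1 / 2 - c') := by
    calc C * bigP D ^ 2 * (D : ℝ) ^ (-c) ≤ |C| * bigP D ^ 2 * (D : ℝ) ^ (-c) := by
          gcongr; exact le_abs_self C
      _ ≤ |C| * bigP D ^ 2 * (D : ℝ) ^ (1 / 2 - c') := by gcongr
  calc ‖∑ p ∈ primeWindow D, χ (p : ZMod D) * calS D D₁ D₂ p κs as‖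
      ≤ 3 * 1 * Cp * (D₁.divisors.card : ℝ) ^ 4 * bigP D ^ 2 * ell D ^ (845 : ℕ) + _ := h1
    _ ≤ 3 * Cp * Cd ^ 4 * bigP D ^ 2 * (D : ℝ) ^ (1 / 2 - c') +
          |C| * bigP D ^ 2 * (D : ℝ) ^ (1 / 2 - c') := add_le_add hprinc (h2.trans hnonp)
    _ = (3 * Cp * Cd ^ 4 + |C|) * bigP D ^ 2 * (D : ℝ) ^ (1 / 2 - c') := by ring

end Literature.NumberTheory.LFunctions.Zhang2022.Typed.Sec14
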